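import Mathlib
import HarnessLib

/-!
# Transcendence measure of a non-zero logarithm of an algebraic number (Cijsouw; Waldschmidt 1978, Cor. 3.7)

Topic `Literature/NumberTheory/Transcendental` (cite item `wi-97874`, requested by the Schanuel
decomposition cell, route `LiouvilleCarving`: hypothesis supplier for the cells `(λ, w)`, `(iλ, w)`).

Waldschmidt, *Transcendence measures for exponentials and logarithms*, J. Austral. Math. Soc.
(Ser. A) 25 (1978) 445–465. Conventions (p. 445): "Let `φ(X, Y)` be a real-valued function defined
for `X ≥ 1` and `Y ≥ log 16` (this is for convenience only). If `ω` is a transcendental number, we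
say that `φ` is a transcendence measure for `ω` if `log |P(ω)| > -φ(N, log H)` for all non-trivial
polynomials `P` in `ℤ[X]` with degree at most `N` and height (in the usual sense) at most `H`";
`Log x = log max(1, x)` (p. 446). §3.2 (pp. 453–454): "Let `α` be a non-zero algebraic number and
let `log α` be a non-zero determination of the logarithm of `α` … The best known result is due to
Cijsouw [Ci 4], and we give a new proof of it", `V = max{h(α), |log α|, 1}`, `d = [ℚ(α) : ℚ]`,
`C(α) = 2³⁸ d³ V (1 + Log d + Log V)`, Theorem 3.6 (an approximation measure) and
**Corollary 3.7: "A transcendence measure for `log α` is `2 C(α) N² (Log H + N Log N)(1 + Log N)⁻¹`."**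
Here the constant is existential, `N ≥ 1` and `H ≥ 16` are naturals (so `Log = log` on them), and
the strict inequality is weakened to `≥` — a consequence of the printed statement (and the text of
the requester's problem-side hypothesis `W78LogMeasure`, so that it is supplied verbatim).

* `Waldschmidt1978_cor_3_7` — the NAMED FACT (a `def … : Prop`, not proved here; users take
  `(h : Waldschmidt1978_cor_3_7)`), stated for `λ : ℂ` with `λ ≠ 0` and `exp λ` algebraic over `ℚ`
  (i.e. `λ` is a non-zero logarithm of the non-zero algebraic number `α = e^λ`), height rendered
  coefficientwise (`∀ k, |P.coeff k| ≤ H`).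
* Proved consequences: the length form `Waldschmidt1978_cor_3_7.of_length` (length
  `L(P) = Σ |aₖ| ≤ H` implies height `≤ H`, the shape of the tree's
  `NesterenkoWaldschmidt1996_thm_2_2` for `π`), and the qualitative corollary
  `Waldschmidt1978_cor_3_7.transcendental`: a non-zero logarithm of an algebraic number is
  transcendental (the Hermite–Lindemann theorem in logarithmic form, here as a one-line consequence
  of the measure: an integer annihilating polynomial would violate the positive lower bound).

Mathlib has `Transcendental`, `IsAlgebraic`, `IsFractionRing.isAlgebraic_iff` (algebraic over `ℤ`
iff over `ℚ`), `Polynomial.aeval`, `Complex.exp`; no transcendence measures. The tree has the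
measure for `π` (`PiTranscendenceMeasure.lean`, proved in `PiTranscendenceMeasureMain.lean`) and
for `e` / `e^β` (`ExpOneTranscendenceMeasure.lean`, `ExpAlgebraicTranscendenceMeasure.lean`), and
Baker's quantitative theorem (`BakerLinearFormsQuantitative.lean`), of which the present corollary
would be a consequence once a root-factorisation/height API exists (requester's remark); not
attempted here.

## References
* M. Waldschmidt, Transcendence measures for exponentials and logarithms, J. Austral. Math. Soc.
  Ser. A 25 (1978), 445–465, Cor. 3.7. [Waldschmidt1978]
* P. L. Cijsouw, Transcendence measures of exponentials and logarithms of algebraic numbers,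
  Compositio Math. 28 (1974), 163–178 (the original measure).
-/

namespace Literature.NumberTheory.Transcendental

open Polynomial

/-- **Waldschmidt 1978, Corollary 3.7 (Cijsouw's transcendence measure for `log α`).** Let `λ ∈ ℂ`
be non-zero with `e^λ = α` algebraic over `ℚ` (so `α ≠ 0` and `λ` is a non-zero determination of
`log α`). Then there is a constant `C > 0` (printed: `2 C(α)`, `C(α) = 2³⁸ d³ V (1 + Log d + Log V)`,
`d = [ℚ(α):ℚ]`, `V = max{h(α), |log α|, 1}`, effectively computable) such that for every non-zero
`P ∈ ℤ[X]` of degree `≤ N` (`N ≥ 1`) whose coefficients satisfy `|aₖ| ≤ H` (usual height `≤ H`,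
`H ≥ 16`): `|P(λ)| ≥ exp(-C · N² · (log H + N log N) / (1 + log N))` — "a transcendence measure for
`log α` is `2C(α) N² (Log H + N Log N)(1 + Log N)⁻¹`" in the convention of p. 445
(`log |P(ω)| > -φ(N, log H)` for all non-trivial `P ∈ ℤ[X]` of degree `≤ N`, height `≤ H`,
`N ≥ 1`, `H ≥ 16`). Existential constant, natural `N, H`, `>` weakened to `≥`.
NAMED FACT, not proved here; users take `(h : Waldschmidt1978_cor_3_7)`.
[cite: Waldschmidt1978, Cor. 3.7 (p. 454; conventions p. 445)] [topic NumberTheory/Transcendental] -/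
def Waldschmidt1978_cor_3_7 : Prop :=
  ∀ lam : ℂ, lam ≠ 0 → IsAlgebraic ℚ (Complex.exp lam) → ∃ C : ℝ, 0 < C ∧
    ∀ (P : Polynomial ℤ) (N H : ℕ), P ≠ 0 → 1 ≤ N → P.natDegree ≤ N → 16 ≤ H →
      (∀ k, |P.coeff k| ≤ (H : ℤ)) →
      Real.exp (-(C * (N : ℝ) ^ 2 * (Real.log H + N * Real.log N) / (1 + Real.log N))) ≤
        ‖Polynomial.aeval lam P‖

namespace Waldschmidt1978_cor_3_7

/-- A bound on the length `L(P) = Σₖ |aₖ|` (sum over `k ≤ deg P`) bounds every coefficient.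
[folklore] -/
private lemma abs_coeff_le_of_sum_le {P : Polynomial ℤ} {H : ℤ}
    (h : (∑ k ∈ Finset.range (P.natDegree + 1), |P.coeff k|) ≤ H) (k : ℕ) :
    |P.coeff k| ≤ H := by
  by_cases hk : k ≤ P.natDegree
  · refine le_trans ?_ h
    exact Finset.single_le_sum (f := fun k => |P.coeff k|) (fun i _ => abs_nonneg _)
      (Finset.mem_range.mpr (Nat.lt_succ_of_le hk))
  · have : P.coeff k = 0 := Polynomial.coeff_eq_zero_of_natDegree_lt (lt_of_not_ge hk)
    rw [this, abs_zero]
    exact le_trans (Finset.sum_nonneg fun i _ => abs_nonneg _) h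

/-- **Length form.** Under `Waldschmidt1978_cor_3_7`, the same lower bound holds for non-zero
`P ∈ ℤ[X]` of degree `≤ N` and LENGTH `L(P) = Σₖ |aₖ| ≤ H` (`H ≥ 16`), since the height is at most
the length — the hypothesis shape of the tree's measure for `π`
(`NesterenkoWaldschmidt1996_thm_2_2`). [cite: Waldschmidt1978, Cor. 3.7 (p. 454)] -/
theorem of_length (h : Waldschmidt1978_cor_3_7) {lam : ℂ} (h0 : lam ≠ 0)
    (halg : IsAlgebraic ℚ (Complex.exp lam)) : ∃ C : ℝ, 0 < C ∧
    ∀ (P : Polynomial ℤ) (N H : ℕ), P ≠ 0 → 1 ≤ N → P.natDegree ≤ N → 16 ≤ H →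
      (∑ k ∈ Finset.range (P.natDegree + 1), |P.coeff k|) ≤ (H : ℤ) →
      Real.exp (-(C * (N : ℝ) ^ 2 * (Real.log H + N * Real.log N) / (1 + Real.log N))) ≤
        ‖Polynomial.aeval lam P‖ := by
  obtain ⟨C, hC, hall⟩ := h lam h0 halg
  exact ⟨C, hC, fun P N H hP hN hdeg hH hlen =>
    hall P N H hP hN hdeg hH (abs_coeff_le_of_sum_le hlen)⟩

/-- **Qualitative corollary (Hermite–Lindemann in logarithmic form).** Under
`Waldschmidt1978_cor_3_7`, a non-zero complex number `λ` with `e^λ` algebraic is transcendental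
over `ℚ`: an annihilating polynomial, cleared of denominators (`IsFractionRing.isAlgebraic_iff`),
would be a non-zero `P ∈ ℤ[X]` with `P(λ) = 0 < exp(−…)`. [cite: Waldschmidt1978, Cor. 3.7 (p. 454)] -/
theorem transcendental (h : Waldschmidt1978_cor_3_7) {lam : ℂ} (h0 : lam ≠ 0)
    (halg : IsAlgebraic ℚ (Complex.exp lam)) : Transcendental ℚ lam := by
  intro hlam
  rw [← IsFractionRing.isAlgebraic_iff ℤ ℚ ℂ] at hlam
  obtain ⟨P, hP, hPl⟩ := hlam
  obtain ⟨C, hC, hall⟩ := h lam h0 halg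
  -- degree bound `N = deg P + 1 ≥ 1`, height bound `H = 16 + Σ |aₖ|`
  set N : ℕ := P.natDegree + 1 with hN
  set S : ℤ := ∑ k ∈ Finset.range (P.natDegree + 1), |P.coeff k| with hS
  have hS0 : 0 ≤ S := Finset.sum_nonneg fun i _ => abs_nonneg _
  set H : ℕ := 16 + S.toNat with hH
  have hHS : S ≤ ((H : ℕ) : ℤ) := by
    rw [hH]; push_cast; rw [Int.toNat_of_nonneg hS0]; omega
  have hcoeff : ∀ k, |P.coeff k| ≤ (H : ℤ) := abs_coeff_le_of_sum_le (le_trans le_rfl hHS)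
  have hb := hall P N H hP (by omega) (by omega) (by omega) hcoeff
  rw [hPl, norm_zero] at hb
  exact absurd hb (not_le.mpr (Real.exp_pos _))

end Waldschmidt1978_cor_3_7

end Literature.NumberTheory.Transcendental
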